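import Mathlib
import HarnessLib
import Summits.Ventures.LatticeQCDFlow.Exactness.IMHKernel
import Summits.Ventures.LatticeQCDFlow.Exactness.KernelSymmetry
import Summits.Ventures.LatticeQCDFlow.Scoring.SymmetricSamplerOddObservables

/-!
# Transporting the flow-sampler kernel by a measurable automorphism: `Θ ∘ indepMH(q, w) ∘ Θ⁻¹ = indepMH(Θ_* q, w ∘ Θ⁻¹)`; a flow whose Jacobian is only MEASURABLE (the spectral flows) gives a sampler symmetric for almost every state, and symmetric IN LAW at every step from every absolutely continuous invariant start

HONEST FRAMING: exact (Metropolis-corrected) sampling algorithms for lattice gauge theory;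
figures of merit are autocorrelation/cost numbers at stated couplings and volumes; no
continuum-physics claim.

Venture `LatticeQCDFlow` (cell pub-lqcd), topic `Exactness`; FANOUT row 10 (`eng-equiv`, engine
`latflow.equiv` / `latflow.flows_jax`: the flow sampler `indepMH q w` of `equiv/imh.py`; Boyda's
`SU(N)` SPECTRAL coupling layers `spectral.py`, whose booked Jacobians are measurable but NOT
continuous — `SpectralDensityMeasurable`, `SUNSpectralKernelShipped`, `EquivariantJacobianGaugeInvariance`'s
a.e. statements).  NEW WORK of the cell; nothing is cited as a fact; no number; no definition is
introduced.  `FlowSamplerTranslationCovariance.conjKernel_indepMH_eq_self` gives EXACT kernel symmetry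
when the weight is invariant EVERYWHERE (continuous Jacobians).  For a measurable Jacobian the
symmetry of the weight holds only almost everywhere (`HasJacobian.jac_siteTranslate_ae_eq`,
`ae_gaugeInvariant_of_hasJacobian`, …); this file supplies what survives.

## What is typed (any measurable space `Ω`, probability `q`, measurable weight `w`, `Θ : Ω ≃ᵐ Ω`)

* **`conjKernel_indepMH`** — THE TRANSPORT IDENTITY, no invariance assumed:
  `conjKernel (indepMH q w) Θ = indepMH (Θ_* q) (w ∘ Θ⁻¹)` — reporting the flow-sampler chain through
  `Θ` is again a flow-sampler chain, with the transported model and weight;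
* `indepMH_apply_congr_of_ae` — two weights agreeing `q`-a.e. give the same transition law from
  every state where they agree; hence **`ae_conjKernel_indepMH_eq`** — if `Θ_* q = q` and
  `w ∘ Θ = w` only `q`-ALMOST EVERYWHERE, then `conjKernel (indepMH q w) Θ x = indepMH q w x` for
  `q`-a.e. state `x`;
* `bind_indepMH_absolutelyContinuous` — the flow-sampler kernel maps laws `μ ≪ q` to laws `≪ q`
  (the proposal part is `≪ q`, the rejection part sits under `μ`); hence
  **`iterate_bind_indepMH_map_eq_self_of_ae`** — from ANY start `μ₀ ≪ q` with `Θ_* μ₀ = μ₀` (the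
  model law `q` itself — the engine's start; the hot start when `q ∼ Haar^⊗`) the law of the run is
  `Θ`-invariant at EVERY step and stays `≪ q`, although the kernel is symmetric only a.e.

NOT here: the instantiation (lattice translations / gauge / conjugation / centre for the spectral
flow sampler: `Θ_* Haar^⊗ = Haar^⊗`, `Ψ ∘ Θ = Θ ∘ Ψ` from `SUNSpectralPlaquetteLayerTranslation` etc.,
`J ∘ Θ = J` a.e. from `HasJacobian.jac_siteTranslate_ae_eq` — then these three theorems apply
verbatim; left to a sequel on built parents); starts not `≪ q` (a cold start sits on a null set
where nothing is claimed); numbers.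
-/

noncomputable section

namespace Summit.Ventures.LatticeQCDFlow.Exactness

open MeasureTheory ProbabilityTheory ProbabilityTheory.Kernel Set
open scoped ENNReal

variable {Ω : Type*} [MeasurableSpace Ω] {q : Measure Ω} [IsProbabilityMeasure q] {w : Ω → ℝ}

/-! ## §1 The transport identity -/

/-- **`Θ ∘ indepMH(q, w) ∘ Θ⁻¹ = indepMH(Θ_* q, w ∘ Θ⁻¹)`** — for every measurable automorphism `Θ`,
no invariance assumed (stated for any presentation `q'` of `Θ_* q`, so that `q' = q` can be
substituted when `Θ` preserves `q`). -/
theorem conjKernel_indepMH (hw : Measurable w) (Θ : Ω ≃ᵐ Ω) (q' : Measure Ω) [IsProbabilityMeasure q']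
    (hq' : q' = q.map Θ) :
    conjKernel (indepMH q w) Θ = indepMH q' (w ∘ Θ.symm) := by
  subst hq'
  have hw' : Measurable (w ∘ Θ.symm) := hw.comp Θ.symm.measurable
  ext x B hB
  rw [conjKernel_apply' _ _ _ hB, indepMH_apply hw _ (Θ.measurable hB), indepMH_apply hw' _ hB]
  -- the proposal part: change variables in the `Θ_* q`-integral
  have hmeas : Measurable fun y => imhAcceptE (w ∘ Θ.symm) x y :=
    (measurable_imhAcceptE hw').comp (measurable_const.prodMk measurable_id)
  have hacc : ∀ y, imhAcceptE (w ∘ Θ.symm) x (Θ y) = imhAcceptE w (Θ.symm x) y := fun y => by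
    simp only [imhAcceptE, imhAccept, Function.comp_apply, Θ.symm_apply_apply]
  have h1 : ∫⁻ y in B, imhAcceptE (w ∘ Θ.symm) x y ∂(q.map Θ) =
      ∫⁻ y in Θ ⁻¹' B, imhAcceptE w (Θ.symm x) y ∂q := by
    rw [setLIntegral_map hB hmeas Θ.measurable]
    simp only [hacc]
  -- the acceptance mass
  have h2 : imhAcceptMass (q.map Θ) (w ∘ Θ.symm) x = imhAcceptMass q w (Θ.symm x) := by
    unfold imhAcceptMass
    rw [lintegral_map_equiv]
    simp only [hacc]
  -- the rejection atom
  have h3 : (Θ ⁻¹' B).indicator (1 : Ω → ℝ≥0∞) (Θ.symm x) = B.indicator 1 x := by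
    by_cases h : x ∈ B
    · rw [Set.indicator_of_mem (show Θ.symm x ∈ Θ ⁻¹' B by
          rw [Set.mem_preimage, Θ.apply_symm_apply]; exact h), Set.indicator_of_mem h]
      rfl
    · rw [Set.indicator_of_notMem (fun h' => h (by rwa [Set.mem_preimage, Θ.apply_symm_apply] at h')),
        Set.indicator_of_notMem h]
  rw [h1, h2, h3]

/-! ## §2 Weights that agree almost everywhere -/

/-- **Two weights agreeing `q`-a.e. give the same flow-sampler transition law from every state where
they agree** (the proposal integral and the acceptance mass only see `q`-a.e. values of the weight
at the proposal; the current state enters through `w x` alone). -/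
theorem indepMH_apply_congr_of_ae {w' : Ω → ℝ} (hw : Measurable w) (hw' : Measurable w')
    (hae : w' =ᵐ[q] w) {x : Ω} (hx : w' x = w x) : indepMH q w' x = indepMH q w x := by
  ext B hB
  rw [indepMH_apply hw' _ hB, indepMH_apply hw _ hB]
  have hacc : (fun y => imhAcceptE w' x y) =ᵐ[q] (fun y => imhAcceptE w x y) := by
    filter_upwards [hae] with y hy
    simp only [imhAcceptE, imhAccept, hy, hx]
  have hmass : imhAcceptMass q w' x = imhAcceptMass q w x := lintegral_congr_ae hacc
  rw [hmass, lintegral_congr_ae (ae_restrict_of_ae hacc)]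

/-- **A flow sampler whose data is symmetric only ALMOST EVERYWHERE is symmetric from almost every
state**: `Θ_* q = q` and `w ∘ Θ = w` `q`-a.e. give `conjKernel (indepMH q w) Θ x = indepMH q w x`
for `q`-a.e. `x`. -/
theorem ae_conjKernel_indepMH_eq (hw : Measurable w) (Θ : Ω ≃ᵐ Ω) (hq : MeasurePreserving Θ q q)
    (hwae : (w ∘ Θ) =ᵐ[q] w) :
    ∀ᵐ x ∂q, conjKernel (indepMH q w) Θ x = indepMH q w x := by
  have hid := conjKernel_indepMH hw Θ q hq.map_eq.symm
  -- `w ∘ Θ⁻¹ = w` almost everywhere as well (`Θ⁻¹` preserves `q`)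
  have hae' : (w ∘ Θ.symm) =ᵐ[q] w := by
    have h := (hq.symm Θ).quasiMeasurePreserving.ae_eq hwae
    have hcomp : (w ∘ Θ) ∘ Θ.symm = w := by
      funext y
      simp only [Function.comp_apply, Θ.apply_symm_apply]
    rw [hcomp] at h
    exact h.symm
  rw [hid]
  filter_upwards [hae'] with x hx
  exact indepMH_apply_congr_of_ae hw (hw.comp Θ.symm.measurable) hae' hx

/-! ## §3 Laws along the run: absolutely continuous invariant starts stay invariant -/

/-- **The flow-sampler kernel maps laws `≪ q` to laws `≪ q`**: the proposal part of `μ K` is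
`≪ q`, the rejection part is dominated by `μ`. -/
theorem bind_indepMH_absolutelyContinuous (hw : Measurable w) {μ : Measure Ω} (hμ : μ ≪ q) :
    μ.bind (indepMH q w) ≪ q := by
  refine Measure.AbsolutelyContinuous.mk fun B hB hqB => ?_
  rw [Measure.bind_apply hB (Kernel.aemeasurable _)]
  have hpt : ∀ x, indepMH q w x B ≤ B.indicator 1 x := fun x => by
    rw [indepMH_apply hw x hB, Measure.restrict_eq_zero.2 hqB, lintegral_zero_measure, zero_add]
    calc (1 - imhAcceptMass q w x) * B.indicator 1 x ≤ 1 * B.indicator 1 x := by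
          gcongr
          exact tsub_le_self
      _ = B.indicator 1 x := one_mul _
  refine le_antisymm ?_ bot_le
  calc ∫⁻ x, indepMH q w x B ∂μ ≤ ∫⁻ x, B.indicator 1 x ∂μ := lintegral_mono hpt
    _ = μ B := lintegral_indicator_one hB
    _ = 0 := hμ hqB
    _ ≤ 0 := le_rfl

/-- **From an absolutely continuous `Θ`-invariant start, the law of an a.e.-symmetric flow-sampler
run is `Θ`-invariant at every step, and stays `≪ q`** (`Θ_* q = q`, `w ∘ Θ = w` a.e.; iterate
spelling `(· .bind K)^[t] μ₀` of `SUNStoutFlowSamplerErgodic`). -/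
theorem iterate_bind_indepMH_map_eq_self_of_ae (hw : Measurable w) (Θ : Ω ≃ᵐ Ω)
    (hq : MeasurePreserving Θ q q) (hwae : (w ∘ Θ) =ᵐ[q] w)
    {μ₀ : Measure Ω} (hμ₀q : μ₀ ≪ q) (hμ₀ : μ₀.map Θ = μ₀) (t : ℕ) :
    ((fun m : Measure Ω => m.bind (indepMH q w))^[t] μ₀).map Θ =
        (fun m : Measure Ω => m.bind (indepMH q w))^[t] μ₀ ∧
      (fun m : Measure Ω => m.bind (indepMH q w))^[t] μ₀ ≪ q := by
  induction t with
  | zero => exact ⟨hμ₀, hμ₀q⟩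
  | succ t ih =>
    obtain ⟨ihmap, ihac⟩ := ih
    rw [Function.iterate_succ_apply']
    refine ⟨?_, bind_indepMH_absolutelyContinuous hw ihac⟩
    rw [Scoring.map_bind_eq_bind_conjKernel, ihmap]
    apply Measure.bind_congr_right
    exact (ae_conjKernel_indepMH_eq hw Θ hq hwae).filter_mono (Measure.AbsolutelyContinuous.ae_le ihac)

/-- The model law itself is an admissible start (`q ≪ q`; `Θ_* q = q`): **from the engine's start
"accept the first proposal" the law of an a.e.-symmetric flow-sampler run is `Θ`-invariant at every
step.** -/
theorem iterate_bind_indepMH_modelStart_map_eq_self_of_ae (hw : Measurable w) (Θ : Ω ≃ᵐ Ω)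
    (hq : MeasurePreserving Θ q q) (hwae : (w ∘ Θ) =ᵐ[q] w) (t : ℕ) :
    ((fun m : Measure Ω => m.bind (indepMH q w))^[t] q).map Θ =
      (fun m : Measure Ω => m.bind (indepMH q w))^[t] q :=
  (iterate_bind_indepMH_map_eq_self_of_ae hw Θ hq hwae Measure.AbsolutelyContinuous.rfl hq.map_eq t).1

end Summit.Ventures.LatticeQCDFlow.Exactness

end
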